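import Mathlib
import HarnessLib
import HarnessLib.Audit
import Summits.Langlands.Statement
import Summits.Langlands.Langlands.Theses.ParahoricFibre
import Literature.NumberTheory.GaloisRepresentations.OrdinaryRegular
import Literature.NumberTheory.GaloisRepresentations.LocalClassFieldTheory
import Literature.NumberTheory.GaloisRepresentations.LocalArtinMapPinned
import Literature.NumberTheory.GaloisRepresentations.ResidualGaloisRep
import Literature.NumberTheory.GaloisRepresentations.WeilDeligneOfGaloisExistence
import Literature.NumberTheory.GaloisRepresentations.GrothendieckDeligneWeilDeligneExistenceHolds
import Summits.Langlands.Langlands.Theses.SmallRangeOrdinaryCarving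

/-! # BC3 birth skeleton (pre-birth twin) for `SmallRangeOrdinaryCarving.OffOrdinaryBoxGenericMonodromy` (DECLARED RESIDUAL, rank 3).  NAMED stubs = the PARENT crux's REGISTERED
skeleton `Cruxes/SmallRangeGenericMonodromy/Lines/birth.lean` re-homed to the residual: stub S1∣OFFBOX `stub_offBoxGenericityPrimeSwitch` (genericity prime
switch, the open core) and stub S2∣OFFBOX `stub_offBoxSmallMonodromyGeneric` (small-monodromy genericity), `¬MB` inserted after `ρ`'s Satake clause, with the
HOST route's items `ParahoricOccurrence`, `OccurrenceToGeneric` BY NAME (admissible, as in the parent skeleton); `OffOrdinaryBoxGenericMonodromy_of` is the parent's dichotomy-by-`π`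
composition, kernel-checked, sorries ONLY inside `stub_*`. -/

set_option linter.dupNamespace false
set_option linter.unusedVariables false

namespace Summit.Langlands.Langlands.Theses.SmallRangeOrdinaryCarving.Birth.OffOrdinaryBoxGenericMonodromy

open scoped BigOperators Topology Manifold Classical MeasureTheory ProbabilityTheory Matrix InnerProductSpace ComplexConjugate ContinuousMap NumberField
open Filter Set Function TopologicalSpace MeasureTheory

/-- verbatim copy of the cell `OffOrdinaryBoxGenericMonodromy` (texts.json; = the route decl by `Iff.rfl` after birth). -/
def OffOrdinaryBoxGenericMonodromy : Prop :=
  open IsDedekindDomain NumberField Polynomial Filter Literature.NumberTheory.Automorphic Literature.NumberTheory.GaloisRepresentations in ∀ (K : Type) [Field K] [NumberField K], NumberField.IsCMField K → ∀ (n : ℕ) (hcpt : isCompact_glFiniteIntegralLevel n K) (π : CuspidalAutomorphicRepData n K hcpt), π.1.IsRegularAlgebraic → ∀ (p : ℕ) [Fact p.Prime] (ι : PadicAlgCl p ≃+* ℂ) (ρ : FramedGaloisRep K (PadicAlgCl p) n), ρ.toGaloisRep.IsSemisimple → (∀ᶠ v : HeightOneSpectrum (𝓞 K) in cofinite, ∀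 α : Multiset ℂ, π.1.HasSatakeParamAt v α → ρ.IsUnramifiedAt v ∧ ρ.HasFrobCharpolyAt v (arithFrobPolyOfSatake ι v.residueCard n α)) → ¬ (n ^ 2 < p ∧ ¬ ((p : ℤ) ∣ NumberField.discr K) ∧ (∀ w : HeightOneSpectrum (𝓞 K), ((p : ℕ) : 𝓞 K) ∈ w.asIdeal → π.1.IsUnramifiedAt w) ∧ (∃ g : GL (Fin n) (PadicAlgCl p), (∀ (σ : Field.absoluteGaloisGroup K) (i j : Fin n), ‖((g * ρ σ * g⁻¹ : GL (Fin n) (PadicAlgCl p)) : Matrix (Fin n) (Fin n) (PadicAlgCl p)) i j‖ ≤ 1) ∧ (∀ M : Matrix (Fin n) (Fin n) ℤ, M.det = 1 → ∃ σ : Field.absoluteGaloisGroup K, ∀ i j : Fin n, ‖((g * ρ σ * g⁻¹ : GL (Fin n) (PadicAlgCl p)) : Matrix (Fin n) (Fin n) (PadicAlgCl p)) i j - ((M i j : ℤ) : PadicAlgCl p)‖ < 1)) ∧ (∃ l : ℕ, l.Prime ∧ l ≠ p ∧ ∀ w : HeightOneSpectrum (𝓞 K), ((l : ℕ) : 𝓞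 K) ∈ w.asIdeal → w.residueCard = l ∧ ρ.IsUnramifiedAt w ∧ ∃ a : Fin n → PadicAlgCl p, ρ.HasFrobCharpolyAt w (∏ i, (X - C (a i))) ∧ ∀ i j : Fin n, i ≠ j → ‖a i - a j‖ = 1 ∧ ‖a i - (l : PadicAlgCl p) * a j‖ = 1)) → ¬ (n ^ 2 < p ∧ (¬ ∃ ζ : K, IsPrimitiveRoot ζ p) ∧ (ρ.restrictField (CyclotomicField p K)).IsResiduallyAbsIrreducible ∧ (∃ l : ℕ, l.Prime ∧ l ≠ p ∧ ¬ (p ∣ (l - 1)) ∧ ¬ ((l : ℤ) ∣ NumberField.discr K) ∧ ∀ w : HeightOneSpectrum (𝓞 K), ((l : ℕ) : 𝓞 K) ∈ w.asIdeal → w.residueCard = l ∧ ρ.IsUnramifiedAt w ∧ ∃ a : Fin n → PadicAlgCl p, ρ.HasFrobCharpolyAt w (∏ i, (X - C (a i))) ∧ ∀ i j : Fin n, i ≠ j → ‖a i - (l : PadicAlgCl p) * a j‖ = 1) ∧ (∀ w : HeightOneSpectrum (𝓞 K), ((p : ℕ) : 𝓞 K) ∈ w.asIdeal → ∀ art : LocalArtinData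 (w.adicCompletion K), art.IsCanonical → ρ.IsOrdinaryRegularAt w art)) → ∀ v : HeightOneSpectrum (𝓞 K), ((p : ℕ) : 𝓞 K) ∉ v.asIdeal → ∃ W : WeilDeligneRep (v.adicCompletion K) (PadicAlgCl p) (Fin n → PadicAlgCl p), IsWeilDeligneOfLadic (ρ.toLocal v).toWeilGroupHom W ∧ ∀ f : (Fin n → PadicAlgCl p) →ₗ[PadicAlgCl p] (Fin n → PadicAlgCl p), (∀ w : WeilGroup (v.adicCompletion K), f ∘ₗ W.ρ w = ((IsNonarchimedeanLocalField.residueFieldCard (v.adicCompletion K) : PadicAlgCl p) ^ (WeilGroup.deg w)) • (W.ρ w ∘ₗ f)) → f ∘ₗ W.N = W.N ∘ₗ f → f = 0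

/-- stub S1∣OFFBOX — the PARENT's registered open stub `stub_genericityPrimeSwitch` (Cruxes/SmallRangeGenericMonodromy/Lines/birth.lean; ℓ-independence of the monodromy / genericity prime switch at v ∤ pp') restricted to OFF-BOX data (¬MB inserted after ρ's Satake clause; `W.IsGeneric` unfolded to the host's inline clause). The DECLARED RESIDUAL's open core; IDEA-NEEDED; head-on FamilyWitnessConsecutiveWeights for non-ordinary p. -/
theorem stub_offBoxGenericityPrimeSwitch :
    open IsDedekindDomain NumberField Polynomial Filter Literature.NumberTheory.Automorphic Literature.NumberTheory.GaloisRepresentations in ∀ (K : Type) [Field K] [NumberField K], NumberField.IsCMField K → ∀ (n : ℕ) (hcpt : isCompact_glFiniteIntegralLevel n K) (π : CuspidalAutomorphicRepData n K hcpt), π.1.IsRegularAlgebraic → ∀ (p : ℕ) [Fact p.Prime] (ι : PadicAlgCl p ≃+* ℂ) (ρ : FramedGaloisRep K (PadicAlgCl p) n), ρ.toGaloisRep.IsSemisimple → (∀ᶠ v : HeightOneSpectrum (𝓞 K) in cofinite, ∀ α : Multiset ℂ, π.1.HasSatakeParamAt v α → ρ.IsUnramifiedAt v ∧ ρ.HasFrobCharpolyAt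 v (arithFrobPolyOfSatake ι v.residueCard n α)) → ¬ (n ^ 2 < p ∧ (¬ ∃ ζ : K, IsPrimitiveRoot ζ p) ∧ (ρ.restrictField (CyclotomicField p K)).IsResiduallyAbsIrreducible ∧ (∃ l : ℕ, l.Prime ∧ l ≠ p ∧ ¬ (p ∣ (l - 1)) ∧ ¬ ((l : ℤ) ∣ NumberField.discr K) ∧ ∀ w : HeightOneSpectrum (𝓞 K), ((l : ℕ) : 𝓞 K) ∈ w.asIdeal → w.residueCard = l ∧ ρ.IsUnramifiedAt w ∧ ∃ a : Fin n → PadicAlgCl p, ρ.HasFrobCharpolyAt w (∏ i, (X - C (a i))) ∧ ∀ i j : Fin n, i ≠ j → ‖a i - (l : PadicAlgCl p) * a j‖ = 1) ∧ (∀ w : HeightOneSpectrum (𝓞 K), ((p : ℕ) : 𝓞 K) ∈ w.asIdeal → ∀ art : LocalArtinData (w.adicCompletion K), art.IsCanonical → ρ.IsOrdinaryRegularAt w art)) → ∀ (p' : ℕ) [Fact p'.Prime] (ι' : PadicAlgCl p' ≃+* ℂ) (ρ' : FramedGaloisRep K (PadicAlgCl p') n), ρ'.toGaloisRep.IsSemisimple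 → (∀ᶠ v : HeightOneSpectrum (𝓞 K) in cofinite, ∀ α : Multiset ℂ, π.1.HasSatakeParamAt v α → ρ'.IsUnramifiedAt v ∧ ρ'.HasFrobCharpolyAt v (arithFrobPolyOfSatake ι' v.residueCard n α)) → (n ^ 2 < p' ∧ ¬ ((p' : ℤ) ∣ NumberField.discr K) ∧ (∀ w : HeightOneSpectrum (𝓞 K), ((p' : ℕ) : 𝓞 K) ∈ w.asIdeal → π.1.IsUnramifiedAt w) ∧ (∃ g : GL (Fin n) (PadicAlgCl p'), (∀ (σ : Field.absoluteGaloisGroup K) (i j : Fin n), ‖((g * ρ' σ * g⁻¹ : GL (Fin n) (PadicAlgCl p')) : Matrix (Fin n) (Fin n) (PadicAlgCl p')) i j‖ ≤ 1) ∧ (∀ M : Matrix (Fin n) (Fin n) ℤ, M.det = 1 → ∃ σ : Field.absoluteGaloisGroup K, ∀ i j : Fin n, ‖((g * ρ' σ * g⁻¹ : GL (Fin n) (PadicAlgCl p')) : Matrix (Fin n) (Fin n) (PadicAlgCl p')) i j - ((M i j : ℤ) : PadicAlgCl p')‖ < 1)) ∧ (∃ l : ℕ, l.Prime ∧ l ≠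 p' ∧ ∀ w : HeightOneSpectrum (𝓞 K), ((l : ℕ) : 𝓞 K) ∈ w.asIdeal → w.residueCard = l ∧ ρ'.IsUnramifiedAt w ∧ ∃ a : Fin n → PadicAlgCl p', ρ'.HasFrobCharpolyAt w (∏ i, (X - C (a i))) ∧ ∀ i j : Fin n, i ≠ j → ‖a i - a j‖ = 1 ∧ ‖a i - (l : PadicAlgCl p') * a j‖ = 1)) → ∀ v : HeightOneSpectrum (𝓞 K), ((p : ℕ) : 𝓞 K) ∉ v.asIdeal → ((p' : ℕ) : 𝓞 K) ∉ v.asIdeal → (∃ W : WeilDeligneRep (v.adicCompletion K) (PadicAlgCl p') (Fin n → PadicAlgCl p'), IsWeilDeligneOfLadic (ρ'.toLocal v).toWeilGroupHom W ∧ ∀ f : (Fin n → PadicAlgCl p') →ₗ[PadicAlgCl p'] (Fin n → PadicAlgCl p'), (∀ w : WeilGroup (v.adicCompletion K), f ∘ₗ W.ρ w = ((IsNonarchimedeanLocalField.residueFieldCard (v.adicCompletion K) : PadicAlgCl p') ^ (WeilGroup.deg w)) • (W.ρ w ∘ₗ f)) → f ∘ₗ W.N = W.N ∘ₗ f → f =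 0) → ∃ W : WeilDeligneRep (v.adicCompletion K) (PadicAlgCl p) (Fin n → PadicAlgCl p), IsWeilDeligneOfLadic (ρ.toLocal v).toWeilGroupHom W ∧ ∀ f : (Fin n → PadicAlgCl p) →ₗ[PadicAlgCl p] (Fin n → PadicAlgCl p), (∀ w : WeilGroup (v.adicCompletion K), f ∘ₗ W.ρ w = ((IsNonarchimedeanLocalField.residueFieldCard (v.adicCompletion K) : PadicAlgCl p) ^ (WeilGroup.deg w)) • (W.ρ w ∘ₗ f)) → f ∘ₗ W.N = W.N ∘ₗ f → f = 0 := by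
  sorry

/-- stub S2∣OFFBOX — the PARENT's registered stub `stub_smallMonodromyGeneric` (genericity for π of small monodromy: no patching datum with p' ∤ v) restricted to OFF-BOX data. -/
theorem stub_offBoxSmallMonodromyGeneric :
    open IsDedekindDomain NumberField Polynomial Filter Literature.NumberTheory.Automorphic Literature.NumberTheory.GaloisRepresentations in ∀ (K : Type) [Field K] [NumberField K], NumberField.IsCMField K → ∀ (n : ℕ) (hcpt : isCompact_glFiniteIntegralLevel n K) (π : CuspidalAutomorphicRepData n K hcpt), π.1.IsRegularAlgebraic → ∀ (p : ℕ) [Fact p.Prime] (ι : PadicAlgCl p ≃+* ℂ) (ρ : FramedGaloisRep K (PadicAlgCl p) n), ρ.toGaloisRep.IsSemisimple → (∀ᶠ v : HeightOneSpectrum (𝓞 K) in cofinite, ∀ α : Multiset ℂ, π.1.HasSatakeParamAt v α → ρ.IsUnramifiedAt v ∧ ρ.HasFrobCharpolyAt v (arithFrobPolyOfSatake ι v.residueCard n α)) → ¬ (n ^ 2 < p ∧ (¬ ∃ ζ : K, IsPrimitiveRoot ζ p) ∧ (ρ.restrictField (CyclotomicField p K)).IsResiduallyAbsIrreducible ∧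 (∃ l : ℕ, l.Prime ∧ l ≠ p ∧ ¬ (p ∣ (l - 1)) ∧ ¬ ((l : ℤ) ∣ NumberField.discr K) ∧ ∀ w : HeightOneSpectrum (𝓞 K), ((l : ℕ) : 𝓞 K) ∈ w.asIdeal → w.residueCard = l ∧ ρ.IsUnramifiedAt w ∧ ∃ a : Fin n → PadicAlgCl p, ρ.HasFrobCharpolyAt w (∏ i, (X - C (a i))) ∧ ∀ i j : Fin n, i ≠ j → ‖a i - (l : PadicAlgCl p) * a j‖ = 1) ∧ (∀ w : HeightOneSpectrum (𝓞 K), ((p : ℕ) : 𝓞 K) ∈ w.asIdeal → ∀ art : LocalArtinData (w.adicCompletion K), art.IsCanonical → ρ.IsOrdinaryRegularAt w art)) → ∀ v : HeightOneSpectrum (𝓞 K), ((p : ℕ) : 𝓞 K) ∉ v.asIdeal → (∀ (p' : ℕ) [Fact p'.Prime] (ι' : PadicAlgCl p' ≃+* ℂ) (ρ' : FramedGaloisRep K (PadicAlgCl p') n), ρ'.toGaloisRep.IsSemisimple → (∀ᶠ v : HeightOneSpectrum (𝓞 K) in cofinite, ∀ α : Multiset ℂ, π.1.HasSatakeParamAt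 v α → ρ'.IsUnramifiedAt v ∧ ρ'.HasFrobCharpolyAt v (arithFrobPolyOfSatake ι' v.residueCard n α)) → ((p' : ℕ) : 𝓞 K) ∉ v.asIdeal → ¬ (n ^ 2 < p' ∧ ¬ ((p' : ℤ) ∣ NumberField.discr K) ∧ (∀ w : HeightOneSpectrum (𝓞 K), ((p' : ℕ) : 𝓞 K) ∈ w.asIdeal → π.1.IsUnramifiedAt w) ∧ (∃ g : GL (Fin n) (PadicAlgCl p'), (∀ (σ : Field.absoluteGaloisGroup K) (i j : Fin n), ‖((g * ρ' σ * g⁻¹ : GL (Fin n) (PadicAlgCl p')) : Matrix (Fin n) (Fin n) (PadicAlgCl p')) i j‖ ≤ 1) ∧ (∀ M : Matrix (Fin n) (Fin n) ℤ, M.det = 1 → ∃ σ : Field.absoluteGaloisGroup K, ∀ i j : Fin n, ‖((g * ρ' σ * g⁻¹ : GL (Fin n) (PadicAlgCl p')) : Matrix (Fin n) (Fin n) (PadicAlgCl p')) i j - ((M i j : ℤ) : PadicAlgCl p')‖ < 1)) ∧ (∃ l : ℕ, l.Prime ∧ l ≠ p' ∧ ∀ w : HeightOneSpectrum (𝓞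 K), ((l : ℕ) : 𝓞 K) ∈ w.asIdeal → w.residueCard = l ∧ ρ'.IsUnramifiedAt w ∧ ∃ a : Fin n → PadicAlgCl p', ρ'.HasFrobCharpolyAt w (∏ i, (X - C (a i))) ∧ ∀ i j : Fin n, i ≠ j → ‖a i - a j‖ = 1 ∧ ‖a i - (l : PadicAlgCl p') * a j‖ = 1))) → ∃ W : WeilDeligneRep (v.adicCompletion K) (PadicAlgCl p) (Fin n → PadicAlgCl p), IsWeilDeligneOfLadic (ρ.toLocal v).toWeilGroupHom W ∧ ∀ f : (Fin n → PadicAlgCl p) →ₗ[PadicAlgCl p] (Fin n → PadicAlgCl p), (∀ w : WeilGroup (v.adicCompletion K), f ∘ₗ W.ρ w = ((IsNonarchimedeanLocalField.residueFieldCard (v.adicCompletion K) : PadicAlgCl p) ^ (WeilGroup.deg w)) • (W.ρ w ∘ₗ f)) → f ∘ₗ W.N = W.N ∘ₗ f → f = 0 := by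
  sorry

open IsDedekindDomain Polynomial Literature.NumberTheory.Automorphic Literature.NumberTheory.GaloisRepresentations in
/-- `OffOrdinaryBoxGenericMonodromy` from the host items `ParahoricOccurrence`, `OccurrenceToGeneric` (BY NAME) and its two stubs (kernel-checked, no sorry): the parent's
dichotomy — a patching datum `(p', ι', ρ')` with `p' ∤ v` exists for `π` (⇒ stub S1∣OFFBOX transports genericity from `ρ'` to `ρ`) or none does (⇒ stub S2∣OFFBOX). -/
theorem OffOrdinaryBoxGenericMonodromy_of
    (hOcc : Summit.Langlands.Langlands.Theses.ParahoricFibre.ParahoricOccurrence) (hOG : Summit.Langlands.Langlands.Theses.ParahoricFibre.OccurrenceToGeneric)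
    (h₁ : open IsDedekindDomain NumberField Polynomial Filter Literature.NumberTheory.Automorphic Literature.NumberTheory.GaloisRepresentations in ∀ (K : Type) [Field K] [NumberField K], NumberField.IsCMField K → ∀ (n : ℕ) (hcpt : isCompact_glFiniteIntegralLevel n K) (π : CuspidalAutomorphicRepData n K hcpt), π.1.IsRegularAlgebraic → ∀ (p : ℕ) [Fact p.Prime] (ι : PadicAlgCl p ≃+* ℂ) (ρ : FramedGaloisRep K (PadicAlgCl p) n), ρ.toGaloisRep.IsSemisimple → (∀ᶠ v : HeightOneSpectrum (𝓞 K) in cofinite, ∀ α : Multiset ℂ, π.1.HasSatakeParamAt v α → ρ.IsUnramifiedAt v ∧ ρ.HasFrobCharpolyAt v (arithFrobPolyOfSatake ι v.residueCard n α)) → ¬ (n ^ 2 < p ∧ (¬ ∃ ζ : K, IsPrimitiveRoot ζ p) ∧ (ρ.restrictField (CyclotomicField p K)).IsResiduallyAbsIrreducible ∧ (∃ l : ℕ, l.Prime ∧ l ≠ p ∧ ¬ (p ∣ (l - 1)) ∧ ¬ ((l : ℤ) ∣ NumberField.discr K) ∧ ∀ w : HeightOneSpectrum (𝓞 K), ((l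 : ℕ) : 𝓞 K) ∈ w.asIdeal → w.residueCard = l ∧ ρ.IsUnramifiedAt w ∧ ∃ a : Fin n → PadicAlgCl p, ρ.HasFrobCharpolyAt w (∏ i, (X - C (a i))) ∧ ∀ i j : Fin n, i ≠ j → ‖a i - (l : PadicAlgCl p) * a j‖ = 1) ∧ (∀ w : HeightOneSpectrum (𝓞 K), ((p : ℕ) : 𝓞 K) ∈ w.asIdeal → ∀ art : LocalArtinData (w.adicCompletion K), art.IsCanonical → ρ.IsOrdinaryRegularAt w art)) → ∀ (p' : ℕ) [Fact p'.Prime] (ι' : PadicAlgCl p' ≃+* ℂ) (ρ' : FramedGaloisRep K (PadicAlgCl p') n), ρ'.toGaloisRep.IsSemisimple → (∀ᶠ v : HeightOneSpectrum (𝓞 K) in cofinite, ∀ α : Multiset ℂ, π.1.HasSatakeParamAt v α → ρ'.IsUnramifiedAt v ∧ ρ'.HasFrobCharpolyAt v (arithFrobPolyOfSatake ι' v.residueCard n α)) → (n ^ 2 < p' ∧ ¬ ((p' : ℤ) ∣ NumberField.discr K) ∧ (∀ w : HeightOneSpectrum (𝓞 K), ((p' : ℕ) : 𝓞 K) ∈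 w.asIdeal → π.1.IsUnramifiedAt w) ∧ (∃ g : GL (Fin n) (PadicAlgCl p'), (∀ (σ : Field.absoluteGaloisGroup K) (i j : Fin n), ‖((g * ρ' σ * g⁻¹ : GL (Fin n) (PadicAlgCl p')) : Matrix (Fin n) (Fin n) (PadicAlgCl p')) i j‖ ≤ 1) ∧ (∀ M : Matrix (Fin n) (Fin n) ℤ, M.det = 1 → ∃ σ : Field.absoluteGaloisGroup K, ∀ i j : Fin n, ‖((g * ρ' σ * g⁻¹ : GL (Fin n) (PadicAlgCl p')) : Matrix (Fin n) (Fin n) (PadicAlgCl p')) i j - ((M i j : ℤ) : PadicAlgCl p')‖ < 1)) ∧ (∃ l : ℕ, l.Prime ∧ l ≠ p' ∧ ∀ w : HeightOneSpectrum (𝓞 K), ((l : ℕ) : 𝓞 K) ∈ w.asIdeal → w.residueCard = l ∧ ρ'.IsUnramifiedAt w ∧ ∃ a : Fin n → PadicAlgCl p', ρ'.HasFrobCharpolyAt w (∏ i, (X - C (a i))) ∧ ∀ i j : Fin n, i ≠ j → ‖a i - a j‖ = 1 ∧ ‖a i - (l : PadicAlgCl p') * a j‖ = 1)) → ∀ v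 : HeightOneSpectrum (𝓞 K), ((p : ℕ) : 𝓞 K) ∉ v.asIdeal → ((p' : ℕ) : 𝓞 K) ∉ v.asIdeal → (∃ W : WeilDeligneRep (v.adicCompletion K) (PadicAlgCl p') (Fin n → PadicAlgCl p'), IsWeilDeligneOfLadic (ρ'.toLocal v).toWeilGroupHom W ∧ ∀ f : (Fin n → PadicAlgCl p') →ₗ[PadicAlgCl p'] (Fin n → PadicAlgCl p'), (∀ w : WeilGroup (v.adicCompletion K), f ∘ₗ W.ρ w = ((IsNonarchimedeanLocalField.residueFieldCard (v.adicCompletion K) : PadicAlgCl p') ^ (WeilGroup.deg w)) • (W.ρ w ∘ₗ f)) → f ∘ₗ W.N = W.N ∘ₗ f → f = 0) → ∃ W : WeilDeligneRep (v.adicCompletion K) (PadicAlgCl p) (Fin n → PadicAlgCl p), IsWeilDeligneOfLadic (ρ.toLocal v).toWeilGroupHom W ∧ ∀ f : (Fin n → PadicAlgCl p) →ₗ[PadicAlgCl p] (Fin n → PadicAlgCl p), (∀ w : WeilGroup (v.adicCompletion K), f ∘ₗ W.ρ w = ((IsNonarchimedeanLocalField.residueFieldCard (v.adicCompletion K) :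 PadicAlgCl p) ^ (WeilGroup.deg w)) • (W.ρ w ∘ₗ f)) → f ∘ₗ W.N = W.N ∘ₗ f → f = 0)
    (h₂ : open IsDedekindDomain NumberField Polynomial Filter Literature.NumberTheory.Automorphic Literature.NumberTheory.GaloisRepresentations in ∀ (K : Type) [Field K] [NumberField K], NumberField.IsCMField K → ∀ (n : ℕ) (hcpt : isCompact_glFiniteIntegralLevel n K) (π : CuspidalAutomorphicRepData n K hcpt), π.1.IsRegularAlgebraic → ∀ (p : ℕ) [Fact p.Prime] (ι : PadicAlgCl p ≃+* ℂ) (ρ : FramedGaloisRep K (PadicAlgCl p) n), ρ.toGaloisRep.IsSemisimple → (∀ᶠ v : HeightOneSpectrum (𝓞 K) in cofinite, ∀ α : Multiset ℂ, π.1.HasSatakeParamAt v α → ρ.IsUnramifiedAt v ∧ ρ.HasFrobCharpolyAt v (arithFrobPolyOfSatake ι v.residueCard n α)) → ¬ (n ^ 2 < p ∧ (¬ ∃ ζ : K, IsPrimitiveRoot ζ p) ∧ (ρ.restrictField (CyclotomicField p K)).IsResiduallyAbsIrreducible ∧ (∃ l : ℕ, l.Prime ∧ l ≠ p ∧ ¬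 (p ∣ (l - 1)) ∧ ¬ ((l : ℤ) ∣ NumberField.discr K) ∧ ∀ w : HeightOneSpectrum (𝓞 K), ((l : ℕ) : 𝓞 K) ∈ w.asIdeal → w.residueCard = l ∧ ρ.IsUnramifiedAt w ∧ ∃ a : Fin n → PadicAlgCl p, ρ.HasFrobCharpolyAt w (∏ i, (X - C (a i))) ∧ ∀ i j : Fin n, i ≠ j → ‖a i - (l : PadicAlgCl p) * a j‖ = 1) ∧ (∀ w : HeightOneSpectrum (𝓞 K), ((p : ℕ) : 𝓞 K) ∈ w.asIdeal → ∀ art : LocalArtinData (w.adicCompletion K), art.IsCanonical → ρ.IsOrdinaryRegularAt w art)) → ∀ v : HeightOneSpectrum (𝓞 K), ((p : ℕ) : 𝓞 K) ∉ v.asIdeal → (∀ (p' : ℕ) [Fact p'.Prime] (ι' : PadicAlgCl p' ≃+* ℂ) (ρ' : FramedGaloisRep K (PadicAlgCl p') n), ρ'.toGaloisRep.IsSemisimple → (∀ᶠ v : HeightOneSpectrum (𝓞 K) in cofinite, ∀ α : Multiset ℂ, π.1.HasSatakeParamAt v α → ρ'.IsUnramifiedAt v ∧ ρ'.HasFrobCharpolyAt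 v (arithFrobPolyOfSatake ι' v.residueCard n α)) → ((p' : ℕ) : 𝓞 K) ∉ v.asIdeal → ¬ (n ^ 2 < p' ∧ ¬ ((p' : ℤ) ∣ NumberField.discr K) ∧ (∀ w : HeightOneSpectrum (𝓞 K), ((p' : ℕ) : 𝓞 K) ∈ w.asIdeal → π.1.IsUnramifiedAt w) ∧ (∃ g : GL (Fin n) (PadicAlgCl p'), (∀ (σ : Field.absoluteGaloisGroup K) (i j : Fin n), ‖((g * ρ' σ * g⁻¹ : GL (Fin n) (PadicAlgCl p')) : Matrix (Fin n) (Fin n) (PadicAlgCl p')) i j‖ ≤ 1) ∧ (∀ M : Matrix (Fin n) (Fin n) ℤ, M.det = 1 → ∃ σ : Field.absoluteGaloisGroup K, ∀ i j : Fin n, ‖((g * ρ' σ * g⁻¹ : GL (Fin n) (PadicAlgCl p')) : Matrix (Fin n) (Fin n) (PadicAlgCl p')) i j - ((M i j : ℤ) : PadicAlgCl p')‖ < 1)) ∧ (∃ l : ℕ, l.Prime ∧ l ≠ p' ∧ ∀ w : HeightOneSpectrum (𝓞 K), ((l : ℕ) : 𝓞 K) ∈ w.asIdeal → w.residueCard =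 l ∧ ρ'.IsUnramifiedAt w ∧ ∃ a : Fin n → PadicAlgCl p', ρ'.HasFrobCharpolyAt w (∏ i, (X - C (a i))) ∧ ∀ i j : Fin n, i ≠ j → ‖a i - a j‖ = 1 ∧ ‖a i - (l : PadicAlgCl p') * a j‖ = 1))) → ∃ W : WeilDeligneRep (v.adicCompletion K) (PadicAlgCl p) (Fin n → PadicAlgCl p), IsWeilDeligneOfLadic (ρ.toLocal v).toWeilGroupHom W ∧ ∀ f : (Fin n → PadicAlgCl p) →ₗ[PadicAlgCl p] (Fin n → PadicAlgCl p), (∀ w : WeilGroup (v.adicCompletion K), f ∘ₗ W.ρ w = ((IsNonarchimedeanLocalField.residueFieldCard (v.adicCompletion K) : PadicAlgCl p) ^ (WeilGroup.deg w)) • (W.ρ w ∘ₗ f)) → f ∘ₗ W.N = W.N ∘ₗ f → f = 0) :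
    OffOrdinaryBoxGenericMonodromy := by
  intro K _ _ hK n hcpt π hπ p _ ι ρ hss hsat _hoff hMB v hv
  by_cases hfull :
      ∃ (p' : ℕ) (_ : Fact p'.Prime) (ι' : PadicAlgCl p' ≃+* ℂ) (ρ' : FramedGaloisRep K (PadicAlgCl
      p') n), ρ'.toGaloisRep.IsSemisimple ∧ (∀ᶠ v : HeightOneSpectrum (𝓞 K) in cofinite, ∀ α :
      Multiset ℂ, π.1.HasSatakeParamAt v α → ρ'.IsUnramifiedAt v ∧ ρ'.HasFrobCharpolyAt v
      (arithFrobPolyOfSatake ι' v.residueCard n α)) ∧ ((p' : ℕ) : 𝓞 K) ∉ v.asIdeal ∧ (n ^ 2 < p' ∧ ¬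
      ((p' : ℤ) ∣ NumberField.discr K) ∧ (∀ w : HeightOneSpectrum (𝓞 K), ((p' : ℕ) : 𝓞 K) ∈
      w.asIdeal → π.1.IsUnramifiedAt w) ∧ (∃ g : GL (Fin n) (PadicAlgCl p'), (∀ (σ :
      Field.absoluteGaloisGroup K) (i j : Fin n), ‖((g * ρ' σ * g⁻¹ : GL (Fin n) (PadicAlgCl p')) :
      Matrix (Fin n) (Fin n) (PadicAlgCl p')) i j‖ ≤ 1) ∧ (∀ M : Matrix (Fin n) (Fin n) ℤ, M.det = 1
      → ∃ σ : Field.absoluteGaloisGroup K, ∀ i j : Fin n, ‖((g * ρ' σ * g⁻¹ : GL (Fin n) (PadicAlgCl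
      p')) : Matrix (Fin n) (Fin n) (PadicAlgCl p')) i j - ((M i j : ℤ) : PadicAlgCl p')‖ < 1)) ∧ (∃
      l : ℕ, l.Prime ∧ l ≠ p' ∧ ∀ w : HeightOneSpectrum (𝓞 K), ((l : ℕ) : 𝓞 K) ∈ w.asIdeal →
      w.residueCard = l ∧ ρ'.IsUnramifiedAt w ∧ ∃ a : Fin n → PadicAlgCl p', ρ'.HasFrobCharpolyAt w
      (∏ i, (X - C (a i))) ∧ ∀ i j : Fin n, i ≠ j → ‖a i - a j‖ = 1 ∧ ‖a i - (l : PadicAlgCl p') * a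
      j‖ = 1))
  · obtain ⟨p', hp', ι', ρ', hss', hsat', hv', hrange'⟩ := hfull
    obtain ⟨W', hW', hgen'⟩ := hOG hOcc K hK n hcpt π hπ p' ι' ρ' hss' hsat' hrange' v hv'
    obtain ⟨W, hW, hgen⟩ := h₁ K hK n hcpt π hπ p ι ρ hss hsat hMB p' ι' ρ' hss' hsat' hrange' v hv hv'
      ⟨W', hW', hgen'⟩
    exact ⟨W, hW, hgen⟩
  · obtain ⟨W, hW, hgen⟩ := h₂ K hK n hcpt π hπ p ι ρ hss hsat hMB v hv (by
      intro p' hp' ι' ρ' hss' hsat' hv' hrange'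
      exact hfull ⟨p', hp', ι', ρ', hss', hsat', hv', hrange'⟩)
    exact ⟨W, hW, hgen⟩

/-- The skeleton concludes the cell BY NAME from the host items and the registered stubs. -/
theorem OffOrdinaryBoxGenericMonodromy_of_stubs (hOcc : Summit.Langlands.Langlands.Theses.ParahoricFibre.ParahoricOccurrence) (hOG : Summit.Langlands.Langlands.Theses.ParahoricFibre.OccurrenceToGeneric) : OffOrdinaryBoxGenericMonodromy :=
  OffOrdinaryBoxGenericMonodromy_of hOcc hOG stub_offBoxGenericityPrimeSwitch stub_offBoxSmallMonodromyGeneric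

/-- identity with the born route decl (elaborates only AFTER birth). -/
theorem OffOrdinaryBoxGenericMonodromy_iff_route : OffOrdinaryBoxGenericMonodromy ↔ Summit.Langlands.Langlands.Theses.SmallRangeOrdinaryCarving.OffOrdinaryBoxGenericMonodromy := Iff.rfl

/-- the ROUTE decl from the host items and the stubs. -/
theorem route_OffOrdinaryBoxGenericMonodromy_of_stubs (hOcc : Summit.Langlands.Langlands.Theses.ParahoricFibre.ParahoricOccurrence) (hOG : Summit.Langlands.Langlands.Theses.ParahoricFibre.OccurrenceToGeneric) : Summit.Langlands.Langlands.Theses.SmallRangeOrdinaryCarving.OffOrdinaryBoxGenericMonodromy :=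
  OffOrdinaryBoxGenericMonodromy_iff_route.1 (OffOrdinaryBoxGenericMonodromy_of_stubs hOcc hOG)

end Summit.Langlands.Langlands.Theses.SmallRangeOrdinaryCarving.Birth.OffOrdinaryBoxGenericMonodromy
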